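import Mathlib
import Summits.ResolutionOfSingularities.ResolutionOfSingularities.Theorems.WeightedInvariantLocalWeightedDropMonicDescentBetaStep

/-!
# `WeightedInvariant.LocalWeightedDrop`, sub-stub N4″: along an infinite Σ**-chain, `2β` stabilises and the tail is β-neutral (T-5′ step (s1))

Crux item stmt-ResolutionOfSingularities-8899 `LocalWeightedDrop` (route `ResolutionOfSingularities/WeightedInvariant`), door
`WeightedConstruction` stmt-ResolutionOfSingularities-0571.  [OURS · L1 W4.3, chain w43, lead prover; step (s1) of the finishing plan `N4PRIME-PLAN.md` §9 for
piece T-5′ `stub_monicDescentNoChain`.  MODEL: Cossart–Jannsen–Saito LNM 2270, proof of Thm 13.7: "the strict inequality may occur in (13.5) only for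
finitely many q. Hence we may assume β_q = β_0 for all q ≥ 0."]

* `IsNeutralStep X Y` — the β-neutral steps of Σ**: blow-up of the permissible `V(y,u₁)`, or a point move answered by `(1:0)` / `(1:λ)`;
* `exists_neutral_tail` — conditional on T-1′, every infinite Σ**-chain of well-prepared reduced positions has a tail consisting of β-neutral steps
  with constant `2β` (from `betaL_succLabels_le`, p490378, and well-foundedness of ℕ).
-/

set_option linter.dupNamespace false -- mandated namespace of this single-conjunct summit

noncomputable section

namespace Summit.ResolutionOfSingularities.ResolutionOfSingularities.Theorems

namespace MonicDescent

open MvPowerSeries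

variable {k : Type} [Field k]

/-- The β-NEUTRAL STEPS of the strategy Σ** from `X` to `Y`: the blow-up of the permissible axis curve `V(y,u₁)`, or (no axis curve permissible, no
graph curve) the point blow-up answered by `(1:0)` or by `(1:λ)`, `λ ≠ 0`. -/
def IsNeutralStep (X Y : Label k) : Prop :=
  (IsPermissibleOne X.1 X.2 ∧ Y = divOneLabel X) ∨
  (¬ IsPermissibleOne X.1 X.2 ∧ ¬ IsPermissibleTwo X.1 X.2 ∧ ¬ HasGraphCurve X ∧
    (Y = blowOneLabel X ∨ ∃ c : k, c ≠ 0 ∧ Y = blowOneLabel (prep (shearLabel (C c) X))))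

variable [CharP k 2] [IsAlgClosed k]

/-- β-STABILISATION: conditional on T-1′, along every infinite Σ**-chain of well-prepared reduced positions `2β` is eventually constant and from then
on every step is β-neutral. -/
theorem exists_neutral_tail
    (hT1 : ∀ (k : Type) [Field k] [CharP k 2] [IsAlgClosed k] (A₀ A₁ : MvPowerSeries (Fin 2) k),
      IsPosition A₀ A₁ → ∃ ψ : MvPowerSeries (Fin 2) k, IsPrepRecentring A₀ A₁ ψ)
    (A : ℕ → Label k)
    (hA : ∀ m, WellPrepared (A m).1 (A m).2 ∧ IsPosition (A m).1 (A m).2 ∧ ¬ IsDoublePlane (A m).1 (A m).2 ∧ A (m + 1) ∈ succLabels (A m)) :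
    ∃ M : ℕ, ∀ m, M ≤ m →
      betaL (newtonSet (A m).1 (A m).2) = betaL (newtonSet (A M).1 (A M).2) ∧ IsNeutralStep (A m) (A (m + 1)) := by
  set f : ℕ → ℕ := fun m => betaL (newtonSet (A m).1 (A m).2) with hf
  have hstep : ∀ m, f (m + 1) ≤ f m ∧ (f (m + 1) = f m → IsNeutralStep (A m) (A (m + 1))) := by
    intro m
    obtain ⟨hwp, hpos, hred, hsucc⟩ := hA m
    exact betaL_succLabels_le hT1 (A m) hwp hpos hred (A (m + 1)) hsucc
  have hanti : ∀ m n, m ≤ n → f n ≤ f m := by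
    intro m n hmn
    induction n, hmn using Nat.le_induction with
    | base => exact le_rfl
    | succ n _ ih => exact le_trans (hstep n).1 ih
  -- the minimum value of `f` is attained at some `M`; from there on `f` is constant
  obtain ⟨M, hM⟩ : ∃ M, ∀ n, f M ≤ f n := by
    have hne : (Set.range f).Nonempty := ⟨f 0, 0, rfl⟩
    obtain ⟨M, hMv⟩ : sInf (Set.range f) ∈ Set.range f := Nat.sInf_mem hne
    exact ⟨M, fun n => by rw [hMv]; exact Nat.sInf_le ⟨n, rfl⟩⟩
  refine ⟨M, fun m hm => ?_⟩
  have hfm : f m = f M := le_antisymm (hanti M m hm) (hM m)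
  have hfm1 : f (m + 1) = f M := le_antisymm (hanti M (m + 1) (by omega)) (hM (m + 1))
  exact ⟨hfm, (hstep m).2 (by rw [hfm1, hfm])⟩

end MonicDescent

end Summit.ResolutionOfSingularities.ResolutionOfSingularities.Theorems

end
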